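import Summits.HubbardSuperconductivity.HubbardSuperconductivity.Theorems.SoloBlindThermalPenaltyEntropy
import Summits.HubbardSuperconductivity.HubbardSuperconductivity.Theorems.SoloBlindPenaltyCeiling
import HarnessLib

/-!
# The one-temperature criterion lives at `β_L = Ω(L²)`: the thermal penalty ceiling

Solo programme `solo-HubbardSuperconductivity-blind`, structural Theorem 18(g). Theorem 18
(`SoloBlindThermalPenaltyEntropy`) shows `HubbardSuperconductivity` ⟺ at every large even side `L`
there are `s_L, β_L > 0` with `4 log 2 ≤ β_L s_L c L²` such that the canonical Gibbs state of the
doped sector for the penalised `H_L + s_L Δ_d†Δ_d` has d-wave order `≥ c L⁴`. Here we show that in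
ANY such pair the penalty is small and the temperature is low:

* `thermal_penalty_ceiling`: for `H = hubbardTorus 2 L t U`, `O = Δ_g†Δ_g` (`|g| ≤ 1`), a joint
  sector `K = (N, S^z)` with `N ≥ 2`, `K ≠ 0`, and `s, β > 0` with `4 log 2 ≤ β s c L²` and sector
  Gibbs order `re ⟨O⟩_{β, H+sO} ≥ c L⁴`: `s c L⁴ ≤ 192 π² |t| M²` and `log 2 · L² ≤ 48 π² |t| M² β`
  for every `M < L` with `M c ≥ 2400`.
* `one_temperature_scale`: the summit's form (`t = 1`, d-wave, doped `S^z = 0` sector):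
  `s ≤ 192π²⌈2400/c⌉²/(c L⁴)` and `β ≥ log 2 · L²/(48 π² ⌈2400/c⌉²)`.

No passivity / free-energy argument is needed: by the entropy-price transfer (Theorem 18(c),
`groundState_re_rayleigh_ge_of_sectorGibbs_penalised`) applied to `A = H + (s/4)O`, `B = A + (3s/4)O`,
every sector ground state of the quarter-penalised `A` keeps order `≥ c L⁴ − (4/3) log dim K/(βs)
≥ c L⁴/3`, and the ground-state penalty ceiling (Theorem 18(f),
`penalty_mul_order_le_of_penalised_groundState`, symmetrised gauge twists) bounds `s/4`.
So the one-temperature route to the summit runs at the pair-rotor scale `T_L = O(|t| / (c² L²))`,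
never at an `L`-independent temperature. [this work]
-/

namespace Summit.HubbardSuperconductivity.HubbardSuperconductivity.Theorems

open Matrix Finset Literature.MathematicalPhysics.QuantumLattice

/-- **Thermal penalty ceiling.** Let `H = hubbardTorus 2 L t U` (`L = n+1 ≥ 3`), `O = Δ_g†Δ_g` with
`|g| ≤ 1`, `K` the joint sector `(N, S^z = Mz)` with `N ≥ 2` and `K ≠ 0`, and let `s, β > 0` satisfy
`4 log 2 ≤ β s c L²` and `c L⁴ ≤ re (tr (P_K e^{-β(H+sO)} O) / tr (P_K e^{-β(H+sO)}))`. Then for every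
`M < L` with `M c ≥ 2400`: `s c L⁴ ≤ 192 π² |t| M²` and `log 2 · L² ≤ 48 π² |t| M² β`. [this work] -/
theorem thermal_penalty_ceiling {n : ℕ} (hL : 3 ≤ n + 1) (t U : ℝ) (g : (Fin 2 → ℤ) → ℝ)
    (hg : ∀ e, |g e| ≤ 1) {N : ℕ} (hN2 : 2 ≤ N) {Mz : ℝ}
    (hKne : szSector (Λ := FermionTorus 2 (n + 1)) N Mz ≠ ⊥) {s β c : ℝ} (hs : 0 < s)
    (hβ : 0 < β) {M : ℕ} (hML : M < n + 1) (hMc : 2400 ≤ (M : ℝ) * c)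
    (htemp : 4 * Real.log 2 ≤ β * s * c * ((n + 1 : ℕ) : ℝ) ^ 2)
    (hth : c * ((n + 1 : ℕ) : ℝ) ^ 4 ≤
      ((projMatrix ((szSector (Λ := FermionTorus 2 (n + 1)) N Mz).map
            ((WithLp.linearEquiv 2 ℂ (Fock (Orb (FermionTorus 2 (n + 1))))).symm :
              Fock (Orb (FermionTorus 2 (n + 1))) →ₗ[ℂ]
                EuclideanSpace ℂ (Finset (Orb (FermionTorus 2 (n + 1)))))) *
          gibbsWeight β (hubbardTorus 2 (n + 1) t U + (s : ℂ) •
            ((pairField g (n + 1))ᴴ * pairField g (n + 1))) *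
          ((pairField g (n + 1))ᴴ * pairField g (n + 1))).trace /
        (projMatrix ((szSector (Λ := FermionTorus 2 (n + 1)) N Mz).map
            ((WithLp.linearEquiv 2 ℂ (Fock (Orb (FermionTorus 2 (n + 1))))).symm :
              Fock (Orb (FermionTorus 2 (n + 1))) →ₗ[ℂ]
                EuclideanSpace ℂ (Finset (Orb (FermionTorus 2 (n + 1)))))) *
          gibbsWeight β (hubbardTorus 2 (n + 1) t U + (s : ℂ) •
            ((pairField g (n + 1))ᴴ * pairField g (n + 1)))).trace).re) :
    s * c * ((n + 1 : ℕ) : ℝ) ^ 4 ≤ 192 * Real.pi ^ 2 * |t| * (M : ℝ) ^ 2 ∧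
      Real.log 2 * ((n + 1 : ℕ) : ℝ) ^ 2 ≤ 48 * Real.pi ^ 2 * |t| * (M : ℝ) ^ 2 * β := by
  set K : Submodule ℂ (Fock (Orb (FermionTorus 2 (n + 1)))) := szSector N Mz with hK
  set H := hubbardTorus 2 (n + 1) t U with hH
  set Δ := pairField g (n + 1) with hΔ
  set O := Δᴴ * Δ with hO
  -- the quarter-penalised Hamiltonian `A = H + (s/4) O`, with `H + s O = A + (3s/4) O`
  set A := H + ((s / 4 : ℝ) : ℂ) • O with hA
  have hdecomp : H + (s : ℂ) • O = A + ((3 * s / 4 : ℝ) : ℂ) • O := by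
    rw [hA, add_assoc, ← add_smul, ← Complex.ofReal_add]
    congr 2
    ring
  have hAh : A.IsHermitian := isHermitian_penalised t U (s / 4) g
  have hOh : O.IsHermitian := isHermitian_conjTranspose_mul_self _
  have hKA : ∀ v ∈ K, A *ᵥ v ∈ K := fun v hv => penalised_mulVec_mem_szSector t U (s / 4) g hN2 hv
  have hKO : ∀ v ∈ K, O *ᵥ v ∈ K := by
    intro v hv
    rw [hO, ← mulVec_mulVec]
    have h := PairTower.pairField_conjTranspose_mulVec_mem_szSector g
      (PairTower.pairField_mulVec_mem_szSector g hv)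
    rwa [Nat.sub_add_cancel hN2] at h
  -- a sector ground state of `A` inherits order `≥ c L⁴ - log dim K / (β · 3s/4)`
  obtain ⟨φ, hφK, hφ1, hφA⟩ := exists_unit_eigen_minEnergyOn hAh K hKA hKne
  rw [hdecomp] at hth
  have hs' : 0 < 3 * s / 4 := by positivity
  have hφO := groundState_re_rayleigh_ge_of_sectorGibbs_penalised hAh hOh K hKA hKO hs' hβ hth
    hφK hφ1 hφA
  have hlog := log_finrank_submodule_fock_le n K
  have hL2 : (0 : ℝ) ≤ ((n + 1 : ℕ) : ℝ) ^ 2 := by positivity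
  have hβs : 0 < β * (3 * s / 4) := mul_pos hβ hs'
  have hprice : Real.log (Module.finrank ℂ K) / (β * (3 * s / 4)) ≤
      2 * (c * ((n + 1 : ℕ) : ℝ) ^ 4) / 3 := by
    rw [div_le_iff₀ hβs]
    have h2 := mul_le_mul_of_nonneg_right htemp hL2
    calc Real.log (Module.finrank ℂ K) ≤ 2 * ((n + 1 : ℕ) : ℝ) ^ 2 * Real.log 2 := hlog
      _ ≤ β * s * c * ((n + 1 : ℕ) : ℝ) ^ 2 * ((n + 1 : ℕ) : ℝ) ^ 2 / 2 := by linarith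
      _ = 2 * (c * ((n + 1 : ℕ) : ℝ) ^ 4) / 3 * (β * (3 * s / 4)) := by ring
  -- so `φ` is a penalised ground state (coupling `s/4`) with order `≥ (c/3) L⁴`
  have hord : c / 3 * ((n + 1 : ℕ) : ℝ) ^ 4 ≤ (star (Δ *ᵥ φ) ⬝ᵥ (Δ *ᵥ φ)).re := by
    have h : (star φ ⬝ᵥ (O *ᵥ φ)).re = (star (Δ *ᵥ φ) ⬝ᵥ (Δ *ᵥ φ)).re := by
      rw [hO, ← mulVec_mulVec, dotProduct_mulVec _ Δᴴ, ← star_mulVec]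
    rw [← h]
    linarith
  have hgs : IsGroundStateInSector
      (hubbardTorus 2 (n + 1) t U + ((s / 4 : ℝ) : ℂ) • ((pairField g (n + 1))ᴴ * pairField g (n + 1)))
      N Mz φ :=
    ⟨hφK, fun h0 => by simp [h0] at hφ1, hφA⟩
  have hMc' : 800 ≤ (M : ℝ) * (c / 3) := by linarith
  have hkey := penalty_mul_order_le_of_penalised_groundState hL t U g hg (s := s / 4) (c := c / 3)
    (by positivity) hML hMc' hgs hφ1 hord
  have h1 : s * c * ((n + 1 : ℕ) : ℝ) ^ 4 ≤ 192 * Real.pi ^ 2 * |t| * (M : ℝ) ^ 2 := by linarith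
  refine ⟨h1, ?_⟩
  -- `4 log 2 · L² ≤ β s c L⁴ ≤ β · 192π²|t|M²`
  have h2 := mul_le_mul_of_nonneg_right htemp hL2
  have h3 := mul_le_mul_of_nonneg_left h1 hβ.le
  have h4 : β * s * c * ((n + 1 : ℕ) : ℝ) ^ 2 * ((n + 1 : ℕ) : ℝ) ^ 2 =
      β * (s * c * ((n + 1 : ℕ) : ℝ) ^ 4) := by ring
  rw [h4] at h2
  linarith

/-- **The one-temperature scale of the summit.** In the one-temperature criterion equivalent to
`HubbardSuperconductivity` (`hubbardSuperconductivity_iff_penalised_thermal_entropy`), at every even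
side `L = n+1 > ⌈2400/c⌉` (and `L ≥ 3`) any admissible pair `(s, β)` — `s, β > 0`,
`4 log 2 ≤ β s c L²`, d-wave order `≥ c L⁴` in the canonical Gibbs state of the doped `S^z = 0`
sector for `hubbardTorus 2 L 1 U + s Δ_d†Δ_d` — satisfies
`s ≤ 192 π² ⌈2400/c⌉² / (c L⁴)` and `β ≥ log 2 · L² / (48 π² ⌈2400/c⌉²)`:
the route runs at the pair-rotor temperature scale `T_L = O(1/(c² L²))`. [this work] -/
theorem one_temperature_scale (U : ℝ) {δ c : ℝ} (hδ : δ ∈ Set.Ioo (0 : ℝ) (1 / 2)) (hc : 0 < c)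
    {n : ℕ} (hn : Even (n + 1)) (hL : 3 ≤ n + 1) (hLc : ⌈2400 / c⌉₊ < n + 1) {s β : ℝ}
    (hs : 0 < s) (hβ : 0 < β) (htemp : 4 * Real.log 2 ≤ β * s * c * ((n + 1 : ℕ) : ℝ) ^ 2)
    (hth : c * ((n + 1 : ℕ) : ℝ) ^ 4 ≤
      ((projMatrix ((szSector (Λ := FermionTorus 2 (n + 1))
            (2 * ⌊(1 - δ) * ((n + 1 : ℕ) : ℝ) ^ 2 / 2⌋₊) 0).map
            ((WithLp.linearEquiv 2 ℂ (Fock (Orb (FermionTorus 2 (n + 1))))).symm :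
              Fock (Orb (FermionTorus 2 (n + 1))) →ₗ[ℂ]
                EuclideanSpace ℂ (Finset (Orb (FermionTorus 2 (n + 1)))))) *
          gibbsWeight β (hubbardTorus 2 (n + 1) 1 U + (s : ℂ) •
            ((pairField dWaveFormFactor (n + 1))ᴴ * pairField dWaveFormFactor (n + 1))) *
          ((pairField dWaveFormFactor (n + 1))ᴴ * pairField dWaveFormFactor (n + 1))).trace /
        (projMatrix ((szSector (Λ := FermionTorus 2 (n + 1))
            (2 * ⌊(1 - δ) * ((n + 1 : ℕ) : ℝ) ^ 2 / 2⌋₊) 0).map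
            ((WithLp.linearEquiv 2 ℂ (Fock (Orb (FermionTorus 2 (n + 1))))).symm :
              Fock (Orb (FermionTorus 2 (n + 1))) →ₗ[ℂ]
                EuclideanSpace ℂ (Finset (Orb (FermionTorus 2 (n + 1)))))) *
          gibbsWeight β (hubbardTorus 2 (n + 1) 1 U + (s : ℂ) •
            ((pairField dWaveFormFactor (n + 1))ᴴ *
              pairField dWaveFormFactor (n + 1)))).trace).re) :
    s ≤ 192 * Real.pi ^ 2 * (⌈2400 / c⌉₊ : ℝ) ^ 2 / (c * ((n + 1 : ℕ) : ℝ) ^ 4) ∧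
      Real.log 2 * ((n + 1 : ℕ) : ℝ) ^ 2 / (48 * Real.pi ^ 2 * (⌈2400 / c⌉₊ : ℝ) ^ 2) ≤ β := by
  obtain ⟨hN2, hKne⟩ := dopedSector_two_le_and_ne_bot U hδ hn
  have hMc : 2400 ≤ (⌈2400 / c⌉₊ : ℝ) * c := by
    have h := Nat.le_ceil (2400 / c)
    rw [div_le_iff₀ hc] at h
    exact h
  obtain ⟨h1, h2⟩ := thermal_penalty_ceiling hL 1 U dWaveFormFactor
    GaugeTwist.abs_dWaveFormFactor_le_one hN2 hKne hs hβ hLc hMc htemp hth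
  rw [abs_one, mul_one] at h1 h2
  have hL4 : (0 : ℝ) < ((n + 1 : ℕ) : ℝ) ^ 4 := by positivity
  have hM0 : (0 : ℝ) < (⌈2400 / c⌉₊ : ℝ) := by
    have : (0 : ℝ) < (⌈2400 / c⌉₊ : ℝ) * c := lt_of_lt_of_le (by norm_num) hMc
    nlinarith
  refine ⟨?_, ?_⟩
  · rw [le_div_iff₀ (mul_pos hc hL4)]
    nlinarith [h1]
  · rw [div_le_iff₀ (by positivity)]
    nlinarith [h2]

end Summit.HubbardSuperconductivity.HubbardSuperconductivity.Theorems
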